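import Summits.KontsevichZagierPeriods.KontsevichZagierPeriods.Theses.HermiteRigidity
import Literature.NumberTheory.Transcendental.AyoubPeriodSeries
import Literature.NumberTheory.Transcendental.AyoubPeriodSeriesKernel
import Literature.NumberTheory.Transcendental.AyoubPeriodSeriesPiAlgebraic
import Literature.NumberTheory.Transcendental.AyoubPeriodSeriesLocalizing
import Literature.NumberTheory.Transcendental.BakerLogarithms

/-!
# Sketch — crux-ideate r1/ideator 1 for `AyoubEffectiveCubeKernel` (stmt-KontsevichZagierPeriods-18116)

First lemmas (signatures over existing declarations; the few marked PROVED are kernel-checked) for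
the two idea cards of this seat:

* Card A `marked-curve-division` — §A: the one-input-variable sector of X₂, its genus-0 sub-sector,
  the square-Stokes identity in `𝒪_{ℚ-alg}(𝔻̄^∞)` and the "exact integer dlog relation" certificate
  target of the N-th-root / N-division contraction.
* Card B `cube-relative-hermite-normal-form` — §B: the dilation/telescoping identity
  `relAC i (dil i c G) = c • dil i c (pdz i G) − G|_{zᵢ=c} + G|_{zᵢ=0}` (PROVED), the affine
  subdivision statement, and the genus-0 normal-form lemmas.

Nothing here is landed; it is the ideator's scratch file (crux-ideate protocol: First lemma must
elaborate).
-/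

noncomputable section

set_option linter.dupNamespace false

namespace Summit.KontsevichZagierPeriods.KontsevichZagierPeriods.Cruxes.AyoubEffectiveCubeKernel.Ideator1

open Literature.NumberTheory.Transcendental
open Literature.NumberTheory.Transcendental.AyoubRel
open Summit.KontsevichZagierPeriods.KontsevichZagierPeriods.Theses.HermiteRigidity (AyoubEffectiveCubeKernel)

/-- The `ℚ`-span of the type-(a) elements over `𝒪_{ℚ-alg}(𝔻̄^∞)` — the target subspace `S` of X₂. -/
def typeASpan : Set CSeries :=
  kSpan (Rat.castHom ℂ) {x : CSeries | ∃ G ∈ Oan (Rat.castHom ℂ), ∃ i : ℕ, x = relAC i G}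

/-- X₂ unfolded through `typeASpan` (definitional). -/
theorem crux_iff : AyoubEffectiveCubeKernel ↔
    ∀ F ∈ Oan (Rat.castHom ℂ), intC F = 0 → F ∈ typeASpan := Iff.rfl

/-! ## §A  Card A — one input variable = marked-curve 1-periods -/

/-- **C₁ — the ONE-INPUT-VARIABLE SECTOR of X₂.** Integrands depending on `z₀` only (certificates
`G` in arbitrarily many variables). Values are the classical 1-periods `∫_γ y dx` of the marked
curve `(C_F, {P₀, P₁})`; Huber–Wüstholz Thm 9.7 decides every vanishing. -/
def OneVariableCubeKernel : Prop :=
  ∀ F ∈ Oan (Rat.castHom ℂ), DependsOnlyOnLT F 1 → intC F = 0 → F ∈ typeASpan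

/-- The sector is a consequence of the crux (PROVED, trivial). -/
theorem oneVariableCubeKernel_of_crux (h : AyoubEffectiveCubeKernel) : OneVariableCubeKernel :=
  fun F hF _ h0 => h F hF h0

/-- `1/(α − z₀) = Σₙ α^{-(n+1)} z₀ⁿ` as an element of `ℂ[[z]]` (the convention of `AyoubRel.perGerm`;
`∫₀¹ dz/(α − z) = −log(1 − α⁻¹)`). For `|α| > 1` and `α` algebraic it lies in `𝒪_{ℚ-alg}(𝔻̄^∞)`. -/
def poleGerm (α : ℂ) : CSeries :=
  fun a => if a = Finsupp.single 0 (a 0) then (α⁻¹) ^ (a 0 + 1) else 0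

/-- **Genus-0 target of Card A (the provable-now rung): an EXACT integer dlog relation is type (a).**
If `∏ⱼ (1 − αⱼ⁻¹)^{eⱼ} = 1` *and the chosen logarithms sum to zero exactly*
(`Σ eⱼ log(1 − αⱼ⁻¹) = 0`, principal branch — automatic winding bookkeeping since `|αⱼ| > 1`), then
`Σ eⱼ /(αⱼ − z₀) ∈ S`. Proof plan (card A, N-th-root contraction): `R(z) = ∏ (z − αⱼ)^{eⱼ}` has
`R(1) = R(0)` and log-zero; `H(z,u) = (1−u) R^{1/N}(z) + u R^{1/N}(0)` is algebraic, non-vanishing on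
the closed bidisc for `N ≫ 0`, and the square-Stokes identity below with `K = ∂_z H/H`, `L = ∂_u H/H`
gives `R'/R = N · (K|_{u=0} − K|_{u=1} − L|_{z=0} + L|_{z=1}) ∈ S`. -/
def ExactDlogRelationInSpan : Prop :=
  ∀ (m : ℕ) (α : Fin m → ℂ) (e : Fin m → ℤ),
    (∀ j, IsAlgebraic ℚ (α j) ∧ 1 < ‖α j‖) →
    (∑ j, (e j : ℂ) * Complex.log (1 - (α j)⁻¹) = 0) →
    (∑ j, (e j : ℂ) • poleGerm (α j)) ∈ typeASpan

/-- **Genus-0 sub-sector of C₁ (Card A, rung 0): dlog normal forms in the kernel are type (a).**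
With Baker (`bakerFin`, PROVED in the tree) a vanishing `β + Σ cⱼ (−log(1 − αⱼ⁻¹))`, `β, cⱼ ∈ ℚ̄`,
has `β = 0` and `c` a `ℚ̄`-combination of exact integer relations, each in `S` by
`ExactDlogRelationInSpan`; `S` is a `ℚ̄`-subspace (`relAC_smul`, `smul_mem_Oan`). -/
def RationalOneVariableCubeKernel : Prop :=
  ∀ (m : ℕ) (α : Fin m → ℂ) (c : Fin m → ℂ) (β : ℂ),
    (∀ j, IsAlgebraic ℚ (α j) ∧ 1 < ‖α j‖) → (∀ j, IsAlgebraic ℚ (c j)) → IsAlgebraic ℚ β →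
    intC (β • (1 : CSeries) + ∑ j, c j • poleGerm (α j)) = 0 →
    β • (1 : CSeries) + ∑ j, c j • poleGerm (α j) ∈ typeASpan

/-- The Baker step of the genus-0 rung, isolated (transcendence input = `bakerFin`, proved in tree). -/
def BakerReductionStep : Prop :=
  bakerFin →
  ∀ (m : ℕ) (α : Fin m → ℂ) (c : Fin m → ℂ) (β : ℂ),
    (∀ j, IsAlgebraic ℚ (α j) ∧ 1 < ‖α j‖) → (∀ j, IsAlgebraic ℚ (c j)) → IsAlgebraic ℚ β →
    β + ∑ j, c j * (- Complex.log (1 - (α j)⁻¹)) = 0 →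
    β = 0 ∧ ∃ (r : ℕ) (lam : Fin r → ℂ) (e : Fin r → Fin m → ℤ),
      (∀ k, IsAlgebraic ℚ (lam k)) ∧
      (∀ k, ∑ j, (e k j : ℂ) * Complex.log (1 - (α j)⁻¹) = 0) ∧
      ∀ j, c j = ∑ k, lam k * (e k j : ℂ)

/-- **Square Stokes in `ℂ[[z]]`, algebraic form (PROVED):** for any `K L` the boundary combination of
the closed-form condition is a difference of two type-(a) elements. -/
theorem relAC_sub_relAC (i j : ℕ) (K L : CSeries) :
    relAC j K - relAC i L =
      (pdz j K - pdz i L) + (restrC j 0 K - restrC j 1 K - restrC i 0 L + restrC i 1 L) := by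
  simp only [relAC]
  abel

/-- **Square Stokes as a membership (PROVED from the identity):** if `K, L ∈ 𝒪_{ℚ-alg}(𝔻̄^∞)` and
`∂_{z_j} K = ∂_{z_i} L` (the 1-form `L dz_j + K dz_i`… is closed), then
`K|_{z_j=0} − K|_{z_j=1} − L|_{z_i=0} + L|_{z_i=1} ∈ S`. This is the workhorse of every
realisation step of Card A (triangle/square Cauchy, N-division contraction). -/
theorem boundary_mem_typeASpan {i j : ℕ} {K L : CSeries}
    (hK : K ∈ Oan (Rat.castHom ℂ)) (hL : L ∈ Oan (Rat.castHom ℂ)) (hclosed : pdz j K = pdz i L) :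
    restrC j 0 K - restrC j 1 K - restrC i 0 L + restrC i 1 L ∈ typeASpan := by
  have h := relAC_sub_relAC i j K L
  rw [hclosed, sub_self, zero_add] at h
  rw [← h]
  refine kSpan_sub (Rat.castHom ℂ) ?_ ?_
  · exact subset_kSpan _ _ ⟨K, hK, j, rfl⟩
  · exact subset_kSpan _ _ ⟨L, hL, i, rfl⟩

/-- **Realisation target of Card A beyond genus 0 (prose-typed, the N-division contraction):**
"a CLOSED algebraic loop `δ : [0,1] → G` in a commutative algebraic group over `ℚ̄` whose abelian
logarithm vanishes contributes `∫_δ η ∈ S` for every closed algebraic 1-form `η` regular along `δ`"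
— stated here only in its cube shadow: the pulled-back integrand `g = (η ∘ δ)·δ'` is a one-variable
element of `𝒪_{ℚ-alg}` and the claim is `g ∈ S`. The hypothesis structure (group, loop, log-zero) is
not yet typeable over the tree (no Jacobians); it is the definition request D1 of the card. -/
def LogZeroLoopInSpan (g : CSeries) : Prop :=
  g ∈ Oan (Rat.castHom ℂ) → DependsOnlyOnLT g 1 → intC g = 0 → g ∈ typeASpan

/-! ## §B  Card B — cube-relative Hermite normal form; subdivision commutes with type (a) -/

/-- Dilation in the variable `zᵢ`: `(dil i c G)(z) = G(…, c·zᵢ, …)`, coefficientwise `c^{aᵢ} g_a`. -/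
def dil (i : ℕ) (c : ℂ) (G : CSeries) : CSeries :=
  fun a => c ^ (a i) * MvPowerSeries.coeff a G

theorem coeff_dil (i : ℕ) (c : ℂ) (G : CSeries) (a : ℕ →₀ ℕ) :
    MvPowerSeries.coeff a (dil i c G) = c ^ (a i) * MvPowerSeries.coeff a G := rfl

/-- `∂ᵢ (G(c zᵢ)) = c · (∂ᵢ G)(c zᵢ)` (PROVED). -/
theorem pdz_dil (i : ℕ) (c : ℂ) (G : CSeries) : pdz i (dil i c G) = c • dil i c (pdz i G) := by
  ext a
  change ((a i : ℂ) + 1) * MvPowerSeries.coeff (a + Finsupp.single i 1) (dil i c G) =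
    c • (c ^ (a i) * (((a i : ℂ) + 1) * MvPowerSeries.coeff (a + Finsupp.single i 1) G))
  rw [coeff_dil]
  simp only [Finsupp.coe_add, Pi.add_apply, Finsupp.single_eq_same, smul_eq_mul, pow_succ]
  ring

/-- `G(c zᵢ)|_{zᵢ=1} = G|_{zᵢ=c}` (PROVED). -/
theorem restrC_one_dil (i : ℕ) (c : ℂ) (G : CSeries) : restrC i 1 (dil i c G) = restrC i c G := by
  ext a
  change (if a i = 0 then ∑' n : ℕ, MvPowerSeries.coeff (a + Finsupp.single i n) (dil i c G) * 1 ^ n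
      else 0) =
    (if a i = 0 then ∑' n : ℕ, MvPowerSeries.coeff (a + Finsupp.single i n) G * c ^ n else 0)
  split_ifs with h
  · refine tsum_congr fun n => ?_
    rw [coeff_dil]
    simp only [Finsupp.coe_add, Pi.add_apply, Finsupp.single_eq_same, h, zero_add, one_pow,
      mul_one]
    ring
  · rfl

/-- `G(c zᵢ)|_{zᵢ=0} = G|_{zᵢ=0}` (PROVED). -/
theorem restrC_zero_dil (i : ℕ) (c : ℂ) (G : CSeries) : restrC i 0 (dil i c G) = restrC i 0 G := by
  ext a
  change (if a i = 0 then ∑' n : ℕ, MvPowerSeries.coeff (a + Finsupp.single i n) (dil i c G) * 0 ^ n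
      else 0) =
    (if a i = 0 then ∑' n : ℕ, MvPowerSeries.coeff (a + Finsupp.single i n) G * 0 ^ n else 0)
  split_ifs with h
  · rw [tsum_eq_single 0, tsum_eq_single 0]
    · simp [coeff_dil, h]
    · intro n hn; simp [hn]
    · intro n hn; simp [hn]
  · rfl

/-- **TELESCOPING LEMMA (PROVED): type (a) of a dilated primitive.**
`relAC i (G(c zᵢ)) = c · (∂ᵢG)(c zᵢ) − G|_{zᵢ=c} + G|_{zᵢ=0}` — the inner face `zᵢ = c` appears with
the sign that makes the two halves of a subdivided cube telescope. This is the algebraic core of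
"subdivision commutes with Stokes" (Card B: `S^{Nash} ∩ 𝒪_{ℚ-alg} = S`, X₂ ⇔ X₂^{Nash}). -/
theorem relAC_dil (i : ℕ) (c : ℂ) (G : CSeries) :
    relAC i (dil i c G) = c • dil i c (pdz i G) - restrC i c G + restrC i 0 G := by
  rw [relAC, pdz_dil, restrC_one_dil, restrC_zero_dil]

/-- Affine re-expansion in `zᵢ`: `(shiftDil i c d G)(z) = G(…, c + d·zᵢ, …)` (a convergent
re-expansion for `G ∈ 𝒪(𝔻̄)` when `|c| + |d| <` polyradius; junk `tsum` otherwise). -/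
def shiftDil (i : ℕ) (c d : ℂ) (G : CSeries) : CSeries :=
  fun a => ∑' k : ℕ, (Nat.choose (a i + k) k : ℂ) * c ^ k * d ^ (a i) *
    MvPowerSeries.coeff (a + Finsupp.single i k) G

/-- **AFFINE SUBDIVISION IN S (Card B, first provable statement): splitting the `zᵢ`-interval at a
rational `c` is a combination of type-(a) elements** — `F ≡ c·F(c zᵢ) + (1−c)·F(c + (1−c) zᵢ)`.
Certificate: the closed 1-form `F(zᵢ m(s)) d(zᵢ m(s))`, `m(s) = 1 − (1−c)s` (or a Möbius-tempered
`m` when the polyradius is close to 1), through `boundary_mem_typeASpan`, plus variable renaming. -/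
def AffineSubdivisionInSpan : Prop :=
  ∀ F ∈ Oan (Rat.castHom ℂ), ∀ (i : ℕ) (c : ℚ), 0 < c → c < 1 →
    F - ((c : ℂ) • dil i c F + ((1 - c : ℚ) : ℂ) • shiftDil i c (1 - c) F) ∈ typeASpan

/-- **Iterated subdivision (consequence): `F ≡ Σ_v F_v`, `F_v = q^{-n} F((v+z)/q)`**, stated for one
variable direction and `q` pieces. -/
def SubdivisionInSpan : Prop :=
  ∀ F ∈ Oan (Rat.castHom ℂ), ∀ (i q : ℕ), 1 ≤ q →
    F - ∑ v ∈ Finset.range q,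
      ((q : ℂ)⁻¹) • shiftDil i ((v : ℂ) / q) ((q : ℂ)⁻¹) F ∈ typeASpan

/-- **Genus-0 NORMAL FORM, exact pieces (Card B, rung n = 1; provable now):** monomials reduce to
their integral … -/
def MonomialNormalForm : Prop :=
  ∀ (d : ℕ), (MvPowerSeries.monomial (Finsupp.single 0 d) (1 : ℂ) : CSeries)
      - (((d : ℂ) + 1)⁻¹) • (1 : CSeries) ∈ typeASpan

/-- … and higher-order poles `(α − z₀)^{-(k+2)}` (power series `poleGermPow`) reduce to constants:
their primitives `(α − z₀)^{-(k+1)}/(k+1)` are algebraic of polyradius `|α| > 1`. Together with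
`MonomialNormalForm` every rational one-variable `F ∈ 𝒪_{ℚ-alg}` is `≡ β·1 + Σ cⱼ/(αⱼ − z₀)` mod `S`
(partial fractions = the de Rham normal form of `(ℙ¹ ∖ {αⱼ, ∞}, {0,1})`). -/
def poleGermPow (α : ℂ) (k : ℕ) : CSeries :=
  fun a => if a = Finsupp.single 0 (a 0) then (Nat.choose (a 0 + k) k : ℂ) * (α⁻¹) ^ (a 0 + k + 1) else 0

def PoleOrderNormalForm : Prop :=
  ∀ (α : ℂ) (k : ℕ), IsAlgebraic ℚ α → 1 < ‖α‖ →
    poleGermPow α (k + 1) - (intC (poleGermPow α (k + 1))) • (1 : CSeries) ∈ typeASpan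

/-- **Card B's organising statement (prose-typed): REDUCTION IS FREE ⇒ X₂ = per-datum rigidity.**
Its checkable n = 1 shadow: C₁ restricted to dlog normal forms is `RationalOneVariableCubeKernel`;
the implication "normal form + kernel-on-normal-forms ⇒ sector" is the template below (PROVED). -/
theorem sector_template {NF K : Set CSeries}
    (hNF : ∀ F ∈ Oan (Rat.castHom ℂ), DependsOnlyOnLT F 1 → ∃ N ∈ NF, F - N ∈ typeASpan ∧ intC N = intC F)
    (hK : ∀ N ∈ NF, intC N = 0 → N ∈ typeASpan) (_hKsub : K ⊆ NF) :
    OneVariableCubeKernel := by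
  intro F hF h1 h0
  obtain ⟨N, hN, hFN, hint⟩ := hNF F hF h1
  have hN0 : intC N = 0 := by rw [hint, h0]
  have h := kSpan_add (Rat.castHom ℂ) hFN (hK N hN hN0)
  rw [sub_add_cancel] at h
  exact h


/-! ## §A'  Card A — the N-division contraction, rank-one torus case (typed) -/

/-- **TORUS LOOP LEMMA (Card A, the lever in its simplest typed instance; provable now).**
A one-variable unit `R ∈ 𝒪_{ℚ-alg}` (non-vanishing on the closed unit disc) with `R(1) = R(0)` and
winding number zero (`∫₀¹ R'/R = 0`) is a CLOSED LOG-ZERO LOOP in `𝔾_m`; the claim is that its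
logarithmic derivative — a kernel element — is of type (a). Certificate: N-th-root contraction
`H(z,u) = (1 − u)·R^{1/N}(z) + u·R^{1/N}(0)` (algebraic, non-vanishing on a closed bidisc for `N ≫ 0`
because `log R` is single-valued and bounded on the closed disc), `K = ∂_z H / H`, `L = ∂_u H / H`,
`boundary_mem_typeASpan`, and `R'/R = N·(K|_{u=0} − K|_{u=1} − L|_{z=0} + L|_{z=1})`. -/
def TorusLoopInSpan : Prop :=
  ∀ R ∈ Oan (Rat.castHom ℂ), DependsOnlyOnLT R 1 →
    (∀ c : ℂ, ‖c‖ ≤ 1 → restrC 0 c R ≠ 0) → restrC 0 1 R = restrC 0 0 R →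
    intC (pdz 0 R * R⁻¹) = 0 → pdz 0 R * R⁻¹ ∈ typeASpan

/-- The genus-0 rung assembled: torus loop lemma + Baker reduction ⇒ the rational one-variable
sector (statement of the implication; the proof is bookkeeping over `typeASpan` being a
`ℚ̄`-subspace, `relAC_smul`/`smul_mem_Oan`). -/
def GenusZeroRung : Prop :=
  TorusLoopInSpan → BakerReductionStep → MonomialNormalForm → PoleOrderNormalForm →
    RationalOneVariableCubeKernel

/-! ## §B'  Card B — room lemma, renaming, locality of `S` along the real cube -/

/-- Polyradius `> R` (same shape as `AyoubRel.HasPolyradiusGtOne`). -/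
def HasPolyradiusGt (R : ℝ) (F : CSeries) : Prop :=
  ∃ r : ℝ, R < r ∧ Summable fun a : ℕ →₀ ℕ => ‖MvPowerSeries.coeff a F‖ * r ^ (Finsupp.degree a)

/-- **ROOM STEP (Card B, first provable statement).** Splitting the `zᵢ`-interval at a rational
`c` close enough to `1`: `F ≡ c·F(c zᵢ) + (1−c)·F(1 − (1−c) zᵢ)  (mod S)` — the second piece is the
right-hand piece in reversed orientation. Certificate: the closed 1-form `F(zᵢ m(z_j)) d(zᵢ m(z_j))`,
`m(s) = 1 − (1−c)s`, in a fresh variable `z_j` (every 1-form in ONE target variable is closed, so no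
primitive is needed), through `boundary_mem_typeASpan`; sup-norm bookkeeping `2 − c < ρ_F`; then the
fresh variable is renamed back (`RenamingInSpan`, room `(ρ_F − 1)/(1 − c) > 3`). -/
def RoomStep : Prop :=
  ∀ F ∈ Oan (Rat.castHom ℂ), ∀ (i : ℕ), ∃ c₀ : ℚ, c₀ < 1 ∧ ∀ c : ℚ, c₀ < c → c < 1 →
    F - ((c : ℂ) • dil i c F + ((1 - c : ℚ) : ℂ) • shiftDil i 1 (-(1 - (c : ℂ))) F) ∈ typeASpan

/-- **ROOM LEMMA (Card B): modulo `S` every `F ∈ 𝒪_{ℚ-alg}(𝔻̄^∞)` is a finite sum of elements of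
polyradius `> R`**, for every `R` (iterate `RoomStep`: the dilated pieces `c^k F(c^k zᵢ)` gain room
geometrically, the end pieces have room `(ρ − 1)/(1 − c)`; one variable at a time). -/
def RoomLemma : Prop :=
  ∀ (R : ℝ), ∀ F ∈ Oan (Rat.castHom ℂ), ∃ (m : ℕ) (P : Fin m → CSeries),
    (∀ j, P j ∈ Oan (Rat.castHom ℂ) ∧ HasPolyradiusGt R (P j)) ∧ F - ∑ j, P j ∈ typeASpan

/-- Renaming `zᵢ ↦ z_j` on coefficients (for `F` not using `z_j`). -/
def renameVar (i j : ℕ) (F : CSeries) : CSeries :=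
  fun b => if b i = 0 then MvPowerSeries.coeff (Finsupp.update (Finsupp.update b i (b j)) j 0) F
    else 0

/-- **RENAMING needs room 2 (Schwarz) and has it at room 3 (Card B):** `F(zᵢ) − F(z_j) ∈ S` via the
closed form `F(φ) dφ`, `φ = zᵢ + z_j − zᵢ z_j` (`φ(·,0) = zᵢ`, `φ(0,·) = z_j`, `φ = 1` on the two
far faces; `sup_{𝔻̄²} |φ| = 3`). Any certificate of this substitution-homotopy shape needs
`ρ_F > 2` (Schwarz lemma on the diagonal), which is why renaming is NOT free in Ayoub's economy and
why the room lemma comes first. -/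
def RenamingInSpan : Prop :=
  ∀ F ∈ Oan (Rat.castHom ℂ), HasPolyradiusGt 3 F → ∀ i j : ℕ, i ≠ j → ¬ UsesVar F j →
    F - renameVar i j F ∈ typeASpan

/-- **LOCALITY / GERM TRANSFER, global half (Card B): zoomed certificates glue.** If every piece of
the `q`-subdivision of `F` (all of `F`'s variables subdivided, pieces re-scaled to the unit cube) is
congruent mod `S` to an algebraic constant, and the constants sum to zero, then `F ∈ S`. With
`SubdivisionInSpan` this is bookkeeping; it is the half of `X₂ ⇔ X₂^{germ}` that lives inside the
tree's formalism (the other half quantifies over functions analytic near the real cube). -/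
def ZoomGluing : Prop :=
  ∀ F ∈ Oan (Rat.castHom ℂ), ∀ (i q : ℕ), 1 ≤ q →
    ∀ (κ : Fin q → ℂ), (∀ v, IsAlgebraic ℚ (κ v)) → ∑ v, κ v = 0 →
    (∀ v : Fin q,
      ((q : ℂ)⁻¹) • shiftDil i ((v : ℕ) / (q : ℂ)) ((q : ℂ)⁻¹) F - κ v • (1 : CSeries) ∈ typeASpan) →
    F ∈ typeASpan

end Summit.KontsevichZagierPeriods.KontsevichZagierPeriods.Cruxes.AyoubEffectiveCubeKernel.Ideator1
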